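import Summits.QuantumFields.YangMills.Theorems.AlphaInputsT3ACv3SmallFactor
import Summits.QuantumFields.Balaban3D.Proofs.FamilyLE
import HarnessLib

/-!
# R3 (cell `ym3-torus`, YM₃ on T³ — a ladder RUNG, NOT d = 4, NOT the Clay problem) — **THE SMALL-FACTORS LEAF (67)–(71) ON ADMISSIBLE HISTORIES FOR THE AC TOWER
# OF A v1 (α) PACKAGE `RunAlphaAC`** (LOCATE `LOCATE-S-ORGAN-w6g7.md` rows T1∕T2; lane-generic)

Seat `ym-ust-19936-w6` g7 (R526 (S) hand).  THEOREMS ONLY (0 `def`, 0 `sorry`); `--supports stmt-QuantumFields-19936 --as helper`; count-neutral; CONDITIONAL on the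
rows `RunAlphaAC.hLF67`∕`h68` of the v1 package (nothing of [Balaban1985UV3] is asserted).

WHY.  The organ rows of R-19936-S∕U (`hSii`∕`hlf`) consume, per ADMISSIBLE history of the AC tower `towerOfAC 𝔠.lane X 𝔖`, the small factors «the part of the action localized
to Δ′(p′) is bounded from below by ¼p²(g_j)» ((69)–(71) p. 273) summed over the recorded large-field plaquettes with the overlap multiplicity of the regions `Δ′`.  The lane proved
this for its STANDARD tower (`Run3SmallFactors.smallFactorsAdm_tower3`, over a `TowerInput`) and, per plaquette, for the v3 package (✓`AlphaV3AC.eq71_perPlaquette_of_alphaV3`);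
THIS FILE is the v1∕AC twin: `card_filter_regionT_le_four'` (multiplicity `≤ 4`, big-block size and collar widths as PARAMETERS), ★ `eq71_perPlaquette_of_alphaAC`
((71) per recorded plaquette from `RunAlphaAC.hLF67`∕`h68`, `PerPlaquette71.perPlaquette71_local_gamma`, `LiftBridge.bridge_liftCfg`), ★★ `smallFactorsAdm_towerOfAC`
(`adm h → (1∕(4N))·Σ_{e∈P(h)} p(g_{e.1})²∕4 ≤ mainT_k(h, U)` for `towerOfAC`, double counting `LargeFieldKnit.sum_sum_mem_le_mul_sum`).

HONEST SCOPE.  Bookkeeping over the package rows and the lane's geometry; nothing of hJ, `hSii`, `hlf`, `stub_pinnedStep`, `HistoryTailL` (19936), the rung, d = 4, a mass gap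
or Clay is proved here.

References: T. Bałaban, Commun. Math. Phys. **102** (1985) 255–275 [Balaban1985UV3] ((67)–(71) p. 273, (39) p. 266, (7) p. 257).
-/

set_option autoImplicit false

noncomputable section

namespace Summit.QuantumFields.YangMills.Theorems.UV3TowerOfACSmallFactorsAdm

open MeasureTheory
open scoped BigOperators Matrix.Norms.L2Operator
open Literature.MathematicalPhysics.QuantumFieldTheory.Balaban1983to89
open Literature.MathematicalPhysics.QuantumFieldTheory.Balaban1985CMP102
open Literature.MathematicalPhysics.QuantumFieldTheory.Balaban1985CMP102.Setting
open Summit.QuantumFields.Balaban3D.Carriers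
open Summit.QuantumFields.Balaban3D.Proofs.Primitives
open Summit.QuantumFields.Balaban3D.Proofs.ScalesArithmetic (gk_pos gk_le_one g0sq_pos gk_eq_gRun_norm)
open Summit.QuantumFields.Balaban3D.Proofs.GroupModelLieC (lieC)
open Summit.QuantumFields.Balaban3D.Proofs.FamilyLE (thresholds_of_le)
open Summit.QuantumFields.Balaban3D.Proofs.TowerAC
open Summit.QuantumFields.Balaban3D.Proofs.StandardAC
open Summit.QuantumFields.Balaban3D.Proofs.InputsAC
open Summit.QuantumFields.Balaban3D.Proofs.AlphaAC
open Summit.QuantumFields.Balaban3D.Proofs.TorusLift (projSite zOf projSite_mem_plaqCover projSite_injOn_deltaBox)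
open Summit.QuantumFields.Balaban3D.Proofs.AdmissibleRegions (scale_eq_of_mem_plaqCover card_sources_le_four)
open Summit.QuantumFields.Balaban3D.Proofs.LiftBridge (liftCfg liftCfg_mem_unitaryUnits bridge_liftCfg)
open Summit.QuantumFields.Balaban3D.Proofs.Run3SmallFactors (codeZ regionT decode_of_mem_disc src_mem_plaqCover_of_mem_regionT)
open Summit.QuantumFields.Balaban3D.Proofs.PerPlaquette71 (perPlaquette71_local_gamma)
open Summit.QuantumFields.Balaban3D.Proofs.LargeFieldKnit (sum_sum_mem_le_mul_sum)
open B7Prop1Explicit (hol plaqWord)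
open B7Prop2Explicit (avgIter)
open B10Eq70Squaring (deltaBox)

/-! ## §1 Lane-generic: multiplicity, (71) per plaquette and the admissible small factors for the AC tower of a v1 package -/

section Lane

variable {L : ℕ} {S : Scales L} {G : Type} [GaugeGroup G] [MeasurableSpace G] [HaarData G] {𝔊 : GroupModel G} {𝔠 : AlphaConsts L 𝔊.N}
  {X : ExternalInputsAC S G} {𝔖 : ∀ k, StepSeries S G ↥(lieC 𝔊) (nblkOf S 𝔠.lane.carrier k) k} {𝔄 : AlphaDataAC 𝔊 𝔠 X 𝔖}

/-- Multiplicity `≤ 4` of the regions `Δ′(e)`, `e ∈ P(h)`, on an ADMISSIBLE history — the lane's `Run3SmallFactors.card_filter_regionT_le_four` with the big-block size and the collar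
widths as PARAMETERS (its proof reads nothing else of the standard tower input). [cite: Balaban1985UV3, (69)–(71) p.273] -/
theorem card_filter_regionT_le_four' (M₁ : ℕ) (Rcol : ℕ → ℕ) {k : ℕ} (hk : k ≤ S.P.m + S.P.K) {h : Hist S.P k}
    (hh : Hist.Admissible M₁ Rcol k h) (q : Plaq S.P 0) :
    ((Hist.disc h).filter (fun e => q ∈ regionT (S := S) e)).card ≤ 4 := by
  classical
  set F := (Hist.disc h).filter (fun e => q ∈ regionT (S := S) e) with hF
  rcases F.eq_empty_or_nonempty with hE | ⟨e₀, he₀⟩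
  · rw [hE, Finset.card_empty]; norm_num
  obtain ⟨he₀d, hq₀⟩ := Finset.mem_filter.mp he₀
  obtain ⟨j₀, hj₀, p₀, hp₀, rfl, -, -, -⟩ := decode_of_mem_disc he₀d
  obtain ⟨hcov₀, -, -⟩ := src_mem_plaqCover_of_mem_regionT (by omega) p₀ hq₀
  let T : Finset (Plaq S.P j₀) := (h ⟨j₀, hj₀⟩).filter (fun p' => p'.μ = q.μ ∧ p'.ν = q.ν ∧ q.src ∈ plaqCover p')
  have hsub : F ⊆ T.image (fun p' => ((j₀ : ℕ), plaqCode p')) := by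
    intro e he
    obtain ⟨hed, hqe⟩ := Finset.mem_filter.mp he
    obtain ⟨j, hj, p', hp', rfl, -, -, -⟩ := decode_of_mem_disc hed
    obtain ⟨hcov, hμ, hν⟩ := src_mem_plaqCover_of_mem_regionT (by omega) p' hqe
    have hjj : j = j₀ := scale_eq_of_mem_plaqCover M₁ Rcol hh hj hj₀ hp' hp₀ hcov hcov₀
    subst hjj
    exact Finset.mem_image.mpr ⟨p', Finset.mem_filter.mpr ⟨hp', hμ.symm, hν.symm, hcov⟩, rfl⟩
  calc F.card ≤ (T.image (fun p' => ((j₀ : ℕ), plaqCode p'))).card := Finset.card_le_card hsub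
    _ ≤ T.card := Finset.card_image_le
    _ ≤ 4 := card_sources_le_four q.src q.μ q.ν q.hμν T (fun p' hp' => (Finset.mem_filter.mp hp').2)

variable (hle : S.g ^ 2 * S.ε₀ ≤ (min 𝔠.gamma0 1) ^ 2)
include hle

/-- ★ **(71) PER RECORDED LARGE-FIELD PLAQUETTE, FOR THE AC TOWER OF A v1 PACKAGE** (p. 273 L11–22; twin of ✓`AlphaV3AC.eq71_perPlaquette_of_alphaV3` with the rows of `RunAlphaAC`):
on the `≤`-family, for `k ≤ K`, an ADMISSIBLE history `h`, every field `U` and every `e = (j, code p′) ∈ P(h)`,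
`p(g_j)²∕4 ≤ N·((1∕g_k²)·Σ_{q ∈ regionT e} η_k⁻¹[1 − reTr U_k(h,U)(∂q)])` — `PerPlaquette71.perPlaquette71_local_gamma` at the lifted composite minimiser, the rows `hLF67`∕`h68`,
the threshold `γ₇₁` (`FamilyLE.thresholds_of_le`), the bridge `LiftBridge.bridge_liftCfg`. [cite: Balaban1985UV3, (67)–(71) p.273] -/
theorem eq71_perPlaquette_of_alphaAC (hL : 2 ≤ L) (R : RunAlphaAC 𝔊 𝔠 X 𝔖 𝔄) (k : ℕ) (hk : k ≤ S.K) (h : Hist S.P k)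
    (hh : Hist.Admissible 𝔠.lane.carrier.M₁ (rcolOf S 𝔠.lane.carrier) k h) (U : GaugeField S.P k G) (e : ℕ × PlaqCode S.P)
    (he : e ∈ Hist.disc h) :
    B10.pFun 𝔠.lane.carrier.b₀ 𝔠.lane.carrier.p₀ (S.gk e.1) ^ 2 / 4 ≤
      (𝔊.N : ℝ) * ((S.gk k)⁻¹ ^ 2 * ∑ q ∈ regionT e, (S.eta k)⁻¹ * (1 - reTr (GaugeField.plaqHol (X.UkH k h U) q))) := by
  classical
  haveI : NeZero 𝔊.N := ⟨Nat.pos_iff_ne_zero.mp 𝔊.N_pos⟩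
  obtain ⟨j, hj, p', hp', hej, hz, hμ, hν⟩ := decode_of_mem_disc he
  have hμν : e.2.2.1 < e.2.2.2 := by rw [hμ, hν]; exact p'.hμν
  have he1 : e.1 = j := by rw [hej]
  have key := perPlaquette71_local_gamma L hL one_pos (g0sq_pos S) 𝔠.lane.F.b₀_pos 𝔠.lane.F.p₀_pos 𝔠.C68_pos S.gk
    (gk_eq_gRun_norm S) (j := e.1) (k := k) (by omega) ((thresholds_of_le hle e.1 (by omega)).2.2.2.1)
    (liftCfg 𝔊 (X.UkH k h U)) (avgIter L (liftCfg 𝔊 (X.UkH k h U)) e.1) (fun x κ => liftCfg_mem_unitaryUnits 𝔊 _ x κ)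
    (codeZ e) (ne_of_lt hμν) rfl (R.hLF67 k hk h hh U e he) (R.h68 k hk h hh U e he)
  refine key.trans (le_of_eq ?_)
  congr 1
  congr 1
  have h2 : 2 * L ^ e.1 ≤ S.P.sitesPerDir 0 := by
    show 2 * L ^ e.1 ≤ 2 * L ^ (S.m + S.K - 0)
    rw [Nat.sub_zero]
    exact Nat.mul_le_mul_left 2 (Nat.pow_le_pow_right (by omega) (by omega))
  unfold Summit.QuantumFields.Balaban3D.Proofs.Run3SmallFactors.regionT
  rw [dif_pos hμν, @Finset.sum_image _ _ _ _ _ (instDecidableEqPlaq (P := S.P) (j := 0)) _ _ ?inj]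
  · refine Finset.sum_congr rfl fun y _ => ?_
    exact (bridge_liftCfg 𝔊 k (X.UkH k h U) y hμν).symm
  · intro y hy y' hy' hyy
    exact projSite_injOn_deltaBox h2 _ _ _ hy hy' (congrArg Plaq.src hyy)

/-- ★★ **THE SMALL-FACTORS LEAF (67)–(71) ON ADMISSIBLE HISTORIES FOR THE AC TOWER `towerOfAC` OF A v1 PACKAGE** (twin of the lane's `Run3SmallFactors.smallFactorsAdm_tower3`,
`c₁ = 1∕(4N)`): `adm h → (1∕(4N))·Σ_{e∈P(h)} p(g_{e.1})²∕4 ≤ mainT_k(h, U)` — per plaquette `eq71_perPlaquette_of_alphaAC`, globally the multiplicity `≤ 4` of the regions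
(`card_filter_regionT_le_four'`) and double counting (`LargeFieldKnit.sum_sum_mem_le_mul_sum`). [cite: Balaban1985UV3, (67)–(71) p.273] -/
theorem smallFactorsAdm_towerOfAC (hL : 2 ≤ L) (R : RunAlphaAC 𝔊 𝔠 X 𝔖 𝔄) :
    ∀ k, k ≤ S.K → ∀ (U : GaugeField S.P k G) (h : Hist S.P k),
      Hist.Admissible 𝔠.lane.carrier.M₁ (rcolOf S 𝔠.lane.carrier) k h →
        1 / (4 * (𝔊.N : ℝ)) * ∑ e ∈ Hist.disc h, B10.pFun 𝔠.lane.carrier.b₀ 𝔠.lane.carrier.p₀ (S.gk e.1) ^ 2 / 4 ≤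
          (towerOfAC 𝔠.lane X 𝔖).mainT k h U := by
  intro k hk U h hh
  classical
  have hkP : k ≤ S.P.m + S.P.K := by show k ≤ S.m + S.K; omega
  have hN : (0 : ℝ) < 𝔊.N := by exact_mod_cast 𝔊.N_pos
  set act : Plaq S.P 0 → ℝ := fun q => (S.eta k)⁻¹ * (1 - reTr (GaugeField.plaqHol (X.UkH k h U) q)) with hact
  have heta : 0 < S.eta k := by
    show 0 < ((S.P.L : ℝ)⁻¹) ^ k
    exact pow_pos (inv_pos.mpr (by exact_mod_cast S.P.L_pos)) k
  have hact0 : ∀ q, 0 ≤ act q := fun q =>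
    mul_nonneg (inv_nonneg.mpr heta.le) (sub_nonneg.mpr (GaugeGroup.reTr_le_one _))
  have hmain : (S.gk k)⁻¹ ^ 2 * ∑ q, act q = (towerOfAC 𝔠.lane X 𝔖).mainT k h U := rfl
  have h71 : ∀ e ∈ Hist.disc h, B10.pFun 𝔠.lane.carrier.b₀ 𝔠.lane.carrier.p₀ (S.gk e.1) ^ 2 / 4 ≤
      (𝔊.N : ℝ) * ((S.gk k)⁻¹ ^ 2 * ∑ q ∈ regionT (S := S) e, act q) :=
    fun e he => eq71_perPlaquette_of_alphaAC hle hL R k hk h hh U e he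
  have hsum : ∑ e ∈ Hist.disc h, B10.pFun 𝔠.lane.carrier.b₀ 𝔠.lane.carrier.p₀ (S.gk e.1) ^ 2 / 4 ≤
      (𝔊.N : ℝ) * ((S.gk k)⁻¹ ^ 2 * ∑ e ∈ Hist.disc h, ∑ q ∈ regionT (S := S) e, act q) := by
    calc ∑ e ∈ Hist.disc h, B10.pFun 𝔠.lane.carrier.b₀ 𝔠.lane.carrier.p₀ (S.gk e.1) ^ 2 / 4
        ≤ ∑ e ∈ Hist.disc h, (𝔊.N : ℝ) * ((S.gk k)⁻¹ ^ 2 * ∑ q ∈ regionT (S := S) e, act q) := Finset.sum_le_sum h71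
      _ = (𝔊.N : ℝ) * ((S.gk k)⁻¹ ^ 2 * ∑ e ∈ Hist.disc h, ∑ q ∈ regionT (S := S) e, act q) := by
          rw [Finset.mul_sum, Finset.mul_sum]
  have hdc : ∑ e ∈ Hist.disc h, ∑ q ∈ regionT (S := S) e, act q ≤ (4 : ℕ) * ∑ q, act q :=
    sum_sum_mem_le_mul_sum (Hist.disc h) Finset.univ (regionT (S := S)) act (fun q _ => hact0 q)
      (fun _ _ => Finset.subset_univ _) 4 (fun q _ => card_filter_regionT_le_four' _ _ hkP hh q)
  have hg0 : 0 ≤ (S.gk k)⁻¹ ^ 2 := sq_nonneg _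
  calc 1 / (4 * (𝔊.N : ℝ)) * ∑ e ∈ Hist.disc h, B10.pFun 𝔠.lane.carrier.b₀ 𝔠.lane.carrier.p₀ (S.gk e.1) ^ 2 / 4
      ≤ 1 / (4 * (𝔊.N : ℝ)) * ((𝔊.N : ℝ) * ((S.gk k)⁻¹ ^ 2 * ((4 : ℕ) * ∑ q, act q))) := by
        refine mul_le_mul_of_nonneg_left (hsum.trans ?_) (by positivity)
        exact mul_le_mul_of_nonneg_left (mul_le_mul_of_nonneg_left hdc hg0) hN.le
    _ = (S.gk k)⁻¹ ^ 2 * ∑ q, act q := by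
        push_cast
        field_simp
    _ = (towerOfAC 𝔠.lane X 𝔖).mainT k h U := hmain

end Lane

end Summit.QuantumFields.YangMills.Theorems.UV3TowerOfACSmallFactorsAdm

end
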